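import Mathlib
import Summits.MatrixMultiplication.Statement
import Summits.MatrixMultiplication.MatrixMultiplication.Theorems.GraphEquationsServeEngine
import Summits.MatrixMultiplication.MatrixMultiplication.Theorems.GraphEquationsTangentWords

/-!
# Graph equations — THE DEFLATION TOWER, III: tangent programs (M22c, decomp-mm-lens-5 g35)

(supports `MultiplicityReduction`, stmt-MatrixMultiplication-27806; the COST side of the tower,
Lemma 6(i) of NODE-g35.  No new definition.)

Each stage of the deflation tower replaces the current generator set `G_j` by
`G_j ∪ D_j G_j ∪ {h_j·λ^{(j+1)} - 1}`, where `D_j = Σ_x β_x ∂_x` is a derivation whose coefficients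
`β_x` are LINEAR FORMS IN THE NEW KERNEL VARIABLES `λ^{(j+1)}` — in Ostrowski's model (only
nonscalar multiplications count, Bürgisser–Clausen–Shokrollahi (4.2), (14.8)) these are cost-free
affine inputs, so a stage is a TANGENT PROGRAM: every product gate spawns two (`D(uv) = u·Dv + v·Du`,
BCS (7.7)).  This module proves, over an ARBITRARY variable type `σ` (so that the kernel variables may
be adjoined; the AD closure itself is M20c's):

* (imported from M20c `GraphEquationsTangentWords`: `IsNonscalarSeq.derivation_affine[_list]` —
  closure of nonscalar sequences under derivations with affine values on the variables, `× 3` per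
  derivation, `× 3^k` along every sub-word of a list of `k`; the tower: `k = m - 1` stages, words =
  sublists = the generators `G_{m-1}`);
* `IsNonscalarSeq.exists_aeval_affine` — cost-free substitutions keep the nonscalar length
  (BCS Rem. (4.3) with `hs = []`, repackaged);
* `exists_isNonscalarSeq_towerOutputs` — THE COST OF THE TOWER: tests `t_o ∈ ℂ[a,b,c]` free over a
  nonscalar sequence of length `≤ N`, adjoin kernel variables `ι`, apply the words of `k` affine
  derivations of `ℂ[a,b,c,Λ]`, then ANY cost-free affine substitution back to `ℂ[a,b,c]` (the shear by
  the 1-jet of the kernel section followed by `Λ := 0`, NODE-g35 Lemma 6(iv)): the results are free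
  over a nonscalar sequence of length `≤ 3^k·N` in `ℂ[a,b,c]` — the `hspan` input of
  `tensorRank_le_of_jetServed` (M22b) with `N' = 3^{m-1}·N`, whence `R(⟨n,n,n⟩) ≤ 2·3^{m-1}·N`.

No `sorry`.  Sources: Bürgisser–Clausen–Shokrollahi (1997) §4.1 Rem. (4.3), (7.7), (14.8);
Baur–Strassen (1983); Leykin–Verschelde–Zhao, Theoret. Comput. Sci. 359 (2006) §2 (the deflated
system as the original system plus its directional derivative in fresh unknowns).
-/

set_option linter.dupNamespace false

namespace Summit.MatrixMultiplication.MatrixMultiplication.Theorems.GraphEquations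

open MvPolynomial
open Literature.Computability.AlgebraicComplexity
open Literature.Computability.AlgebraicComplexity.ArithCircuit

/-! ## Cost-free substitutions

The AD closure along affine derivations over an arbitrary variable type — `IsNonscalarSeq.derivation_affine`,
`IsNonscalarSeq.derivation_affine_list` (M20c, `GraphEquationsTangentWords`) — is imported; here only
the substitution step is repackaged. -/

section Affine

variable {σ : Type*}

/-- **Cost-free substitutions preserve the nonscalar length** (BCS §4.1 Rem. (4.3) with `hs = []`,
repackaged with a length bound). -/
theorem IsNonscalarSeq.exists_aeval_affine {R : Type*} [CommRing R] {τ : Type*}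
    (θ : σ → MvPolynomial τ R) (hθ : ∀ i, θ i ∈ freeSpan (∅ : Set (MvPolynomial τ R)))
    {gs : List (MvPolynomial σ R)} (hgs : IsNonscalarSeq gs) :
    ∃ gs' : List (MvPolynomial τ R), IsNonscalarSeq gs' ∧ gs'.length ≤ gs.length ∧
      ∀ p ∈ freeSpan {x | x ∈ gs}, aeval θ p ∈ freeSpan {x | x ∈ gs'} := by
  have hθ' : ∀ i, θ i ∈ freeSpan {x | x ∈ ([] : List (MvPolynomial τ R))} := fun i =>
    freeSpan_mono (Set.empty_subset _) (hθ i)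
  obtain ⟨hns, hmem⟩ := IsNonscalarSeq.aeval_append hθ' isNonscalarSeq_nil hgs
  refine ⟨gs.map (aeval θ) ++ [], hns, by simp, hmem⟩

end Affine

/-! ## The cost of the tower -/

section Tower

variable {n : ℕ} {ι ο : Type*}

/-- **THE COST OF THE DEFLATION TOWER.**  Tests `t_o ∈ ℂ[a,b,c]` free over a nonscalar sequence of
length `≤ N`; adjoin kernel variables `ι`; `Ds` a list of `k` derivations of `ℂ[a,b,c,Λ]` with
cost-free values on the variables (the stages `D_j`, coefficients linear in the new kernel variables);
`θ` any cost-free substitution `ℂ[a,b,c,Λ] → ℂ[a,b,c]` (the shear by the affine 1-jet of the kernel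
section, then `Λ := 0`).  THEN all the substituted word-derivatives `θ(D_L t_o)`, `L` a sub-word of
`Ds`, are free over ONE nonscalar sequence of length `≤ 3^k·N` in `ℂ[a,b,c]`. -/
theorem exists_isNonscalarSeq_towerOutputs {N : ℕ} (t : ο → MvPolynomial (GraphVars n) ℂ)
    (hspan : ∃ gs : List (MvPolynomial (GraphVars n) ℂ), IsNonscalarSeq gs ∧ gs.length ≤ N ∧
      ∀ o, t o ∈ freeSpan {q | q ∈ gs})
    (Ds : List (Derivation ℂ (MvPolynomial (GraphVars n ⊕ ι) ℂ) (MvPolynomial (GraphVars n ⊕ ι) ℂ)))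
    (hDs : ∀ D ∈ Ds, ∀ v, D (X v) ∈ freeSpan (∅ : Set (MvPolynomial (GraphVars n ⊕ ι) ℂ)))
    (θ : GraphVars n ⊕ ι → MvPolynomial (GraphVars n) ℂ)
    (hθ : ∀ v, θ v ∈ freeSpan (∅ : Set (MvPolynomial (GraphVars n) ℂ))) :
    ∃ gs' : List (MvPolynomial (GraphVars n) ℂ), IsNonscalarSeq gs' ∧ gs'.length ≤ 3 ^ Ds.length * N ∧
      ∀ o, ∀ L : List (Derivation ℂ (MvPolynomial (GraphVars n ⊕ ι) ℂ) (MvPolynomial (GraphVars n ⊕ ι) ℂ)),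
        L.Sublist Ds →
          aeval θ (L.foldl (fun acc D => D acc)
            (aeval (fun w : GraphVars n => (X (Sum.inl w) : MvPolynomial (GraphVars n ⊕ ι) ℂ)) (t o))) ∈ freeSpan {q | q ∈ gs'} := by
  obtain ⟨gs, hns, hlen, ht⟩ := hspan
  -- (1) adjoin the kernel variables: `rename inl` is a cost-free substitution
  have hX : ∀ v : GraphVars n, (fun w => X (Sum.inl w) : GraphVars n → MvPolynomial (GraphVars n ⊕ ι) ℂ) v ∈
      freeSpan (∅ : Set (MvPolynomial (GraphVars n ⊕ ι) ℂ)) := fun v => X_mem_freeSpan _ _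
  obtain ⟨gs₁, hns₁, hlen₁, hmem₁⟩ := IsNonscalarSeq.exists_aeval_affine (fun w => X (Sum.inl w)) hX hns
  -- (2) the words of the tangent programs
  obtain ⟨gs₂, hns₂, hlen₂, hW⟩ := IsNonscalarSeq.derivation_affine_list Ds hDs hns₁
  -- (3) the final cost-free substitution back to `ℂ[a,b,c]`
  obtain ⟨gs₃, hns₃, hlen₃, hmem₃⟩ := IsNonscalarSeq.exists_aeval_affine θ hθ hns₂
  refine ⟨gs₃, hns₃, ?_, fun o L hL => hmem₃ _ (hW _ ?_ L hL)⟩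
  · calc gs₃.length ≤ gs₂.length := hlen₃
      _ ≤ 3 ^ Ds.length * gs₁.length := hlen₂
      _ ≤ 3 ^ Ds.length * N := Nat.mul_le_mul_left _ (hlen₁.trans hlen)
  · exact hmem₁ (t o) (ht o)

/-- **THE RANK BOUND OF THE TOWER, cost side assembled** (`k` stages ⇒ `R(⟨n,n,n⟩) ≤ 2·3^k·N`):
the served outputs are the substituted words `θ(D_L t_o)` indexed by `o` and a finite family of
sub-words `L_w` of `Ds`; if they serve every generator modulo `a⊗b`-free remainders (which is what
the twist cancellation `coeff_ab_sum_killKernel_eq` of M22b delivers from regularity at the deflated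
point), the rank bound follows. -/
theorem tensorRank_le_of_towerServed {N : ℕ} [Fintype ο] [DecidableEq ο] {W : Type*} [Fintype W]
    [DecidableEq W] (t : ο → MvPolynomial (GraphVars n) ℂ)
    (hspan : ∃ gs : List (MvPolynomial (GraphVars n) ℂ), IsNonscalarSeq gs ∧ gs.length ≤ N ∧
      ∀ o, t o ∈ freeSpan {q | q ∈ gs})
    (Ds : List (Derivation ℂ (MvPolynomial (GraphVars n ⊕ ι) ℂ) (MvPolynomial (GraphVars n ⊕ ι) ℂ)))
    (hDs : ∀ D ∈ Ds, ∀ v, D (X v) ∈ freeSpan (∅ : Set (MvPolynomial (GraphVars n ⊕ ι) ℂ)))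
    (θ : GraphVars n ⊕ ι → MvPolynomial (GraphVars n) ℂ)
    (hθ : ∀ v, θ v ∈ freeSpan (∅ : Set (MvPolynomial (GraphVars n) ℂ)))
    (word : W → List (Derivation ℂ (MvPolynomial (GraphVars n ⊕ ι) ℂ) (MvPolynomial (GraphVars n ⊕ ι) ℂ)))
    (hword : ∀ w, (word w).Sublist Ds)
    (P : Fin n × Fin n → ο × W → ℂ) (r : Fin n × Fin n → MvPolynomial (GraphVars n) ℂ)
    (hrab : ∀ (q : Fin n × Fin n) (i j j' l : Fin n),
      coeff (Finsupp.single (Sum.inl (Sum.inl (i, j)) : GraphVars n) 1 +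
        Finsupp.single (Sum.inl (Sum.inr (j', l)) : GraphVars n) 1) (r q) = 0)
    (hserve : ∀ q, ∑ ow : ο × W, C (P q ow) *
        aeval θ ((word ow.2).foldl (fun acc D => D acc)
          (aeval (fun w : GraphVars n => (X (Sum.inl w) : MvPolynomial (GraphVars n ⊕ ι) ℂ)) (t ow.1))) =
        generator n q + r q) :
    tensorRank (matMulTensor ℂ n n n) ≤ 2 * (3 ^ Ds.length * N) := by
  obtain ⟨gs', hns', hlen', hW⟩ := exists_isNonscalarSeq_towerOutputs t hspan Ds hDs θ hθ
  refine tensorRank_le_of_abServed (N := 3 ^ Ds.length * N)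
    (fun ow : ο × W =>
      aeval θ ((word ow.2).foldl (fun acc D => D acc)
        (aeval (fun w : GraphVars n => (X (Sum.inl w) : MvPolynomial (GraphVars n ⊕ ι) ℂ)) (t ow.1))))
    ?_ P r hrab ?_
  · exact ⟨gs', hns', hlen', fun ow => hW ow.1 _ (hword ow.2)⟩
  · intro q
    exact hserve q

end Tower

end Summit.MatrixMultiplication.MatrixMultiplication.Theorems.GraphEquations
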